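import Literature.Analysis.Calculus.ParamFamilyJetsOfEngine                 -- ★ p851213 (F0P3a-p05 (g20)) J1-CORE: `exists_forall_norm_iteratedFDeriv_le_of_smul_integral_family`
import Literature.NumberTheory.Rogawski1990.ArchCentralJetBoundsAllFrames      -- ★ p851226 (F0P3a-p09 (g7)) (B3-ENGINE): §6 `exists_forall_norm_iteratedFDeriv_rootProduct_smul_orbital_comp_clm_le`, `angleChart_ne_of_mem_chamber_ball`
import Literature.NumberTheory.Automorphic.ArchLocalTorusOrbitalBlockSmooth      -- ★ generic `contDiffAt_integral_comp_of_contDiff_of_support` (Hörmander 1.1.9 with uniform compact support)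
import Literature.NumberTheory.Automorphic.ArchLocalTorusOrbitalContinuity       -- ★ `isCompact_setOf_exists_conj_circleDiagonal_mem` (properness of conjugation at regular torus points)
import Literature.NumberTheory.Rogawski1990.ArchOrbFamGExtFaceJetModel           -- ★ (B2) §0 `exists_nhds_bddAbove_norm_iteratedFDeriv_mul_of_contDiffOn`; brings ★ §1 `bddAbove_norm_iteratedFDeriv_comp_clm_image`, `orbFamGExt`, `InRegG`
import Literature.NumberTheory.Rogawski1990.ArchTransfFamilySymmetries           -- ★ `dense_regG`
import Literature.Analysis.Calculus.ParametricFamilyLocalisation                -- ★ `exists_contDiff_tsupport_subset_eventually_eq_one` (the `q`-cutoff)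
import HarnessLib

/-!
# (B3-JUNCTION) J1 — jets of `orbFamGExt` near a compact SCALAR CORNER from a CENTRAL MODEL: Harish-Chandra's bound at the scalar place, smooth parameters at the others
# (Harish-Chandra ∕ Warner II Thm. 8.4.3.1; Varadarajan 1977 I §1.12; Bouaziz 1994 §3.1 (I₁); Hörmander ALPDO I §1.1)

Topic `NumberTheory/Rogawski1990`; namespaces `Literature.Analysis.Calculus` (§0, generic), `Literature.NumberTheory.Rogawski1990` (§1–§3).  THEOREMS ONLY (no `def`,
no instance, no notation, no axiom, no named fact, no `sorry`).  Cell `pub/hodgecm-mathlib`, crux H413 (`stmt-HodgeConjecture-24833`), F0∕P3c line LH3 (closer stub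
`stub_N9`, DIRECT ROAD `F0_P3c_StubN9Direct`, leaf v5.1), LETTER L1 clause (I₁), organ **O-L1d `stub_N9hcCentralJetBounds`** = the `hC₀` callback of ★ (I₁-asm) ED. 2
`smoothBounded_orbFamGExt_of_strata₄` (scalar at ONE compact place `w ∉ S′`, in-regular at every other compact place); brick **(B3-JUNCTION) J1 «CENTRAL MODEL ⇒ JET
BOUNDS»** (LH3-plan (g4) RULING #18 + DEAL 2026-09-02T11:14:03Z; (I₁) spec-owner LH7-p04 (g4) «= binder» 10:59:29Z on F0P3a-p05 (g20)'s signed text); seat A-p12 (g28)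
typing from F0P3a-p05 (g20)'s plan.  Sequel J2 `ArchOrbFamGExtCentralJetBounds` discharges the model.  Count-neutral.

THE MATHEMATICS.  Near a point `x` of the fundamental cube which is SCALAR at the compact indefinite place `w` (all three eigenvalues `e^{i x_{w l}}` equal, `= ζ`) the
normalised orbital family reads, on the `G`-regular set, `orbFamGExt S′ c = u(c) · π(θ(c)) · ∫_{G_w} Θ(A c, g · diag(ζ e^{iθ(c)}) · g⁻¹) dν_w(g)` with `θ(c)_k = c_{w,τ⁻¹k} − x_{w,τ⁻¹k}`
the angles at `w` measured from the corner, `π = rootProduct` Harish-Chandra's product of positive roots, `u` a smooth unit, `A` a continuous linear chart of the transversal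
parameters (the other places) and `Θ(q, X)` the partial orbital integral over the other places — jointly `C^∞` with uniform compact `G_w`-support (★ (A4′), (J-iso): file J2).
THIS file proves: such a CENTRAL MODEL forces every jet `‖Dⁿ orbFamGExt S′‖` to be bounded on `U′ ∩ InRegG` for a neighbourhood `U′` of `x`.  Ingredients: (J1-par, §1) the model
`Ψ(θ, q) = π(θ) • ∫ Θ(q, g·diag(ζe^{iθ})·g⁻¹) dν` is jointly `C^∞` on `{θ regular} × P` (Hörmander 1.1.9 with the uniform compact support given by the properness of conjugation at
regular torus points, ★ `isCompact_setOf_exists_conj_circleDiagonal_mem`); (J1-loc, §2) on every open Weyl chamber `C_σ ∩ B(0,¼)` times a compact parameter set ALL joint jets of `Ψ` are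
bounded — ★ J1-CORE `exists_forall_norm_iteratedFDeriv_le_of_smul_integral_family` fed with Harish-Chandra's theorem in the CLM-uniform form ★ (B3-ENGINE) §6 (every sign pattern at
`w`); (§3) the dress: a `q`-cutoff making `Θ` global, the affine chart `c ↦ (θ(c), A c)` (★ `bddAbove_norm_iteratedFDeriv_comp_clm_image` after a translation), Leibniz against `u`
(★ `exists_nhds_bddAbove_norm_iteratedFDeriv_mul_of_contDiffOn`), and the passage from the dense open `RegG S′` (where the model is read; ★ `dense_regG`) to `InRegG` — in particular
ACROSS THE COMPACT WALL at `w` (`θ_i = θ_j` with `s w i = s w j`, where the chambers' closures meet) — by the continuity of `Dⁿ orbFamGExt` on the open `InRegG` (hypothesis `h1` =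
clause (I₂), ★ (A5)) (§0 `bddAbove_image_inter_of_dense`).
* §0 `bddAbove_image_inter_of_dense` (generic: a bound on `U ∩ V ∩ D`, `D` dense, `f` continuous on the open `V` ⇒ the bound on `U ∩ V`); `exists_perm_mem_chamber`.
* §1 (J1-par) `contDiffAt_integral_family_conj_circleDiagonal`, **`contDiffOn_rootProduct_smul_integral_family_conj_circleDiagonal`**.
* §2 (J1-loc) **`exists_forall_norm_iteratedFDeriv_rootProduct_smul_integral_family_le`** (one chamber), `…_le_of_injective` (all six).
* §3 HEAD **`exists_nhds_bddAbove_norm_iteratedFDeriv_orbFamGExt_of_centralModel`** (binder form; J2 discharges `hfac`, `h1`).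
HONEST LABEL: the MIXED scalar corners (`hCm`: scalar at `w` + a noncompact coincidence at another compact place, organ O-L1d′) are NOT covered; nothing printed is discharged
by this file alone; HC_CM is proved only modulo the 7 printed citations (2 remaining: hLiu418 = `stmt-HodgeConjecture-24832`, h413 = `stmt-HodgeConjecture-24833`) until
rung 0 closes.

## References
* [WarnerHASSLG2] G. Warner, *Harmonic Analysis on Semi-Simple Lie Groups II*, Grundlehren 189 (1972), Thm. 8.4.3.1 (local boundedness of the derivatives of `π·F_f`).
* [Varadarajan1977] V. S. Varadarajan, *Harmonic Analysis on Real Reductive Groups*, LNM 576 (1977), Part I §1.12 (`'F_f` on `T_{in-reg}`), Part I §3.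
* [Bouaziz1994IntegralesOrbitales] A. Bouaziz, *Intégrales orbitales sur les groupes de Lie réductifs*, Ann. Sci. ÉNS 27 (1994), §3.1 (I₁)–(I₂) p. 579.
* [HormanderALPDO1] L. Hörmander, *The Analysis of Linear Partial Differential Operators I*, Grundlehren 256 (1983), §1.1 Thms. 1.1.8, 1.1.9; §1.4 Thm. 1.4.1.
* [Rogawski1990] J. D. Rogawski, *Automorphic Representations of Unitary Groups in Three Variables*, Ann. of Math. Stud. 123 (1990), §8.2 p. 122, §8.4 p. 126.
-/

set_option autoImplicit false

noncomputable section

open MeasureTheory Measure Filter Topology Set Function Metric NumberField NumberField.InfinitePlace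
open Literature.NumberTheory.Automorphic Literature.NumberTheory.Automorphic.UnitaryGroup Literature.NumberTheory.Automorphic.ArchCartan
open Literature.Geometry.ComplexHyperbolic Literature.Geometry.ComplexHyperbolic.BallModel
open scoped MatrixGroups Matrix.Norms.Operator ContDiff BoundedContinuousFunction Classical

/-! ## §0 Generic: a bound on a dense part passes to the closure inside an open set of continuity; every regular angle lies in a chamber -/

namespace Literature.Analysis.Calculus

/-- **A bound on a DENSE part is a bound**: `f` continuous on the open `V`, `U` open, `D` dense, `f ≤ B` on `U ∩ V ∩ D` ⇒ `f ≤ B` on `U ∩ V` (every point of the open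
`U ∩ V` is in the closure of `U ∩ V ∩ D`, and `f x ∈ closure (f '' (U ∩ V ∩ D)) ⊆ (−∞, B]`). [cite: Varadarajan1977, Part I §1.12] -/
theorem bddAbove_image_inter_of_dense {X : Type*} [TopologicalSpace X] {f : X → ℝ} {U V D : Set X} (hU : IsOpen U) (hV : IsOpen V)
    (hf : ContinuousOn f V) (hD : Dense D) (hb : BddAbove (f '' (U ∩ V ∩ D))) : BddAbove (f '' (U ∩ V)) := by
  obtain ⟨B, hB⟩ := hb
  refine ⟨B, ?_⟩
  rintro _ ⟨x, hx, rfl⟩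
  have hcl : x ∈ closure (U ∩ V ∩ D) := hD.open_subset_closure_inter (hU.inter hV) hx
  have hcont : ContinuousWithinAt f (U ∩ V ∩ D) x :=
    ((hf x hx.2).continuousAt (hV.mem_nhds hx.2)).continuousWithinAt
  have hmem : f x ∈ closure (f '' (U ∩ V ∩ D)) := hcont.mem_closure_image hcl
  have hsub : closure (f '' (U ∩ V ∩ D)) ⊆ Iic B := closure_minimal (fun y hy => hB hy) isClosed_Iic
  exact hsub hmem

/-- Three pairwise distinct reals lie in an open Weyl chamber `θ(σ0) < θ(σ1) < θ(σ2)` (sort them). [cite: Rogawski1990, §8.4 p. 126] -/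
theorem exists_perm_mem_chamber {θ : Fin 3 → ℝ} (hθ : Injective θ) : ∃ σ : Equiv.Perm (Fin 3), θ (σ 0) < θ (σ 1) ∧ θ (σ 1) < θ (σ 2) := by
  refine ⟨Tuple.sort θ, ?_, ?_⟩
  · exact lt_of_le_of_ne (Tuple.monotone_sort θ (by decide)) fun h => by
      have := (Tuple.sort θ).injective (hθ h); exact absurd this (by decide)
  · exact lt_of_le_of_ne (Tuple.monotone_sort θ (by decide)) fun h => by
      have := (Tuple.sort θ).injective (hθ h); exact absurd this (by decide)

end Literature.Analysis.Calculus

namespace Literature.NumberTheory.Rogawski1990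

open Literature.Analysis.Calculus

/-! ## §1 (J1-par) The parametric torus orbital family is jointly `C^∞` at regular angles -/

section Par

variable (L : Type) [Field L] (α : Fin 3 → L) (w : {w : InfinitePlace L // IsComplex w})
  [MeasurableSpace (archLocal L 3 (Matrix.diagonal α) w)] [BorelSpace (archLocal L 3 (Matrix.diagonal α) w)]
  {P : Type*} [NormedAddCommGroup P] [NormedSpace ℝ P] [FiniteDimensional ℝ P]
  {E : Type*} [NormedAddCommGroup E] [NormedSpace ℝ E] [CompleteSpace E]

/-- **(J1-par) JOINT SMOOTHNESS OF THE PARAMETRIC TORUS ORBITAL FAMILY AT A REGULAR ANGLE.**  `ν` finite on compacts on `G_w = U(σ_w diag α)(ℂ)`, `Θ : P × M₃(ℂ) → E` jointly `C^∞`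
with a compact `C ⊆ G_w` off which `Θ(q, ↑↑k) = 0` FOR EVERY parameter `q`; at an angle `θ₀` with `ζ e^{iθ₀}` regular the family `(θ, q) ↦ ∫_{G_w} Θ(q, ↑↑(g·diag(ζe^{iθ})·g⁻¹)) dν`
is `C^∞` at `(θ₀, q₀)` for every `q₀` — ★ Hörmander 1.1.9 with the uniform compact support on `closedBall θ₀ δ × P` given by the properness of conjugation over a compact set of
regular torus points (★ `isCompact_setOf_exists_conj_circleDiagonal_mem`). [cite: HormanderALPDO1, §1.1 Thm. 1.1.9] [cite: Rogawski1990, §8.2 p. 122] -/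
theorem contDiffAt_integral_family_conj_circleDiagonal (hα : ∀ i, α i ≠ 0) (ν : Measure (archLocal L 3 (Matrix.diagonal α) w)) [IsFiniteMeasureOnCompacts ν]
    (Θ : P × Matrix (Fin 3) (Fin 3) ℂ → E) (hΘ : ContDiff ℝ ∞ Θ) {C : Set (archLocal L 3 (Matrix.diagonal α) w)} (hC : IsCompact C)
    (hΘC : ∀ (q : P) (k : archLocal L 3 (Matrix.diagonal α) w), k ∉ C → Θ (q, ((k : GL (Fin 3) ℂ) : Matrix (Fin 3) (Fin 3) ℂ)) = 0)
    (ζ : Circle) {θ₀ : Fin 3 → ℝ} (hθ₀ : Injective fun k => ζ * Circle.exp (θ₀ k)) (q₀ : P) :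
    ContDiffAt ℝ ∞ (fun z : (Fin 3 → ℝ) × P => ∫ g : archLocal L 3 (Matrix.diagonal α) w,
      Θ (z.2, (((g * ⟨circleDiagonal 3 (fun k => ζ * Circle.exp (z.1 k)), circleDiagonal_mem_archLocal_diagonal L 3 α w _⟩ * g⁻¹ :
        archLocal L 3 (Matrix.diagonal α) w) : GL (Fin 3) ℂ) : Matrix (Fin 3) (Fin 3) ℂ)) ∂ν) (θ₀, q₀) := by
  -- the jointly smooth integrand `Ψ((A,B),(θ,q)) = Θ(q, A·diag(ζe^{iθ})·B)` and the continuous datum `y(g) = (↑g, ↑g⁻¹)`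
  set Ψ : (Matrix (Fin 3) (Fin 3) ℂ × Matrix (Fin 3) (Fin 3) ℂ) × ((Fin 3 → ℝ) × P) → E :=
    fun q => Θ (q.2.2, q.1.1 * ((circleDiagonal 3 fun k => ζ * Circle.exp (q.2.1 k) : GL (Fin 3) ℂ) : Matrix (Fin 3) (Fin 3) ℂ) * q.1.2) with hΨ
  have hΨd : ContDiff ℝ ∞ Ψ := by
    refine hΘ.comp ((contDiff_snd.comp contDiff_snd).prodMk ?_)
    exact ((contDiff_fst.comp contDiff_fst).mul ((contDiff_coe_circleDiagonal_angles 3 (fun _ => ζ)).comp (contDiff_fst.comp contDiff_snd))).mul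
      (contDiff_snd.comp contDiff_fst)
  set y : archLocal L 3 (Matrix.diagonal α) w → Matrix (Fin 3) (Fin 3) ℂ × Matrix (Fin 3) (Fin 3) ℂ :=
    fun g => (((g : GL (Fin 3) ℂ) : Matrix (Fin 3) (Fin 3) ℂ), (((g⁻¹ : archLocal L 3 (Matrix.diagonal α) w) : GL (Fin 3) ℂ) : Matrix (Fin 3) (Fin 3) ℂ)) with hy
  have hyc : Continuous y :=
    (Units.continuous_val.comp continuous_subtype_val).prodMk ((Units.continuous_val.comp continuous_subtype_val).comp continuous_inv)
  have hΨy : ∀ (g : archLocal L 3 (Matrix.diagonal α) w) (z : (Fin 3 → ℝ) × P), Ψ (y g, z) =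
      Θ (z.2, (((g * ⟨circleDiagonal 3 (fun k => ζ * Circle.exp (z.1 k)), circleDiagonal_mem_archLocal_diagonal L 3 α w _⟩ * g⁻¹ :
        archLocal L 3 (Matrix.diagonal α) w) : GL (Fin 3) ℂ) : Matrix (Fin 3) (Fin 3) ℂ)) := fun g z => by
    simp only [hΨ, hy, coe_conj_archLocal]
  -- a closed ball of regular angles around `θ₀`
  have hzc : Continuous fun θ : Fin 3 → ℝ => fun k => ζ * Circle.exp (θ k) :=
    continuous_pi fun k => continuous_const.mul (Circle.exp.continuous.comp (continuous_apply k))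
  have hopen : IsOpen {z : Fin 3 → Circle | Injective z} := by
    have h : {z : Fin 3 → Circle | Injective z} = ⋂ p ∈ {p : Fin 3 × Fin 3 | p.1 ≠ p.2}, {z | z p.1 ≠ z p.2} := by
      ext z
      simp only [mem_setOf_eq, mem_iInter, Prod.forall]
      exact ⟨fun hz i j hij h => hij (hz h), fun h i j hij => by_contra fun hne => h i j hne hij⟩
    rw [h]
    exact (Set.toFinite _).isOpen_biInter fun p _ => isOpen_ne_fun (continuous_apply p.1) (continuous_apply p.2)
  obtain ⟨δ, hδ, hball⟩ : ∃ δ > 0, closedBall θ₀ δ ⊆ (fun θ : Fin 3 → ℝ => fun k => ζ * Circle.exp (θ k)) ⁻¹' {z : Fin 3 → Circle | Injective z} := by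
    obtain ⟨ε, hε, hεball⟩ := Metric.mem_nhds_iff.1 ((hopen.preimage hzc).mem_nhds (show θ₀ ∈ _ from hθ₀))
    exact ⟨ε / 2, half_pos hε, (closedBall_subset_ball (half_lt_self hε)).trans hεball⟩
  have hKc : IsCompact ((fun θ : Fin 3 → ℝ => fun k => ζ * Circle.exp (θ k)) '' closedBall θ₀ δ) := (isCompact_closedBall θ₀ δ).image hzc
  have hKreg : (fun θ : Fin 3 → ℝ => fun k => ζ * Circle.exp (θ k)) '' closedBall θ₀ δ ⊆ {z : Fin 3 → Circle | Injective z} := by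
    rintro _ ⟨θ, hθ, rfl⟩; exact hball hθ
  -- the uniform compact support
  have hS := isCompact_setOf_exists_conj_circleDiagonal_mem L 3 α w hα hKc hKreg hC
  have h0 : ∀ g ∉ {g : archLocal L 3 (Matrix.diagonal α) w | ∃ z ∈ (fun θ : Fin 3 → ℝ => fun k => ζ * Circle.exp (θ k)) '' closedBall θ₀ δ,
      g * ⟨circleDiagonal 3 z, circleDiagonal_mem_archLocal_diagonal L 3 α w z⟩ * g⁻¹ ∈ C}, ∀ z ∈ closedBall θ₀ δ ×ˢ (univ : Set P), Ψ (y g, z) = 0 := by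
    intro g hg z hz
    rw [hΨy]
    refine hΘC z.2 _ fun hmem => hg ⟨_, ⟨z.1, hz.1, rfl⟩, hmem⟩
  have hU : closedBall θ₀ δ ×ˢ (univ : Set P) ∈ 𝓝 ((θ₀, q₀) : (Fin 3 → ℝ) × P) :=
    prod_mem_nhds (closedBall_mem_nhds θ₀ hδ) univ_mem
  have key := contDiffAt_integral_comp_of_contDiff_of_support ν Ψ hΨd y hyc ((θ₀, q₀) : (Fin 3 → ℝ) × P) hS hU h0
  refine key.congr_of_eventuallyEq (Eventually.of_forall fun z => ?_)
  exact integral_congr_ae (Eventually.of_forall fun g => (hΨy g z).symm)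

/-- **(J1-par) THE CENTRAL MODEL IS JOINTLY `C^∞` ON `{regular angles} × P`**: with `Θ` as above, `(θ, q) ↦ rootProduct θ • ∫_{G_w} Θ(q, ↑↑(g·diag(ζe^{iθ})·g⁻¹)) dν` is
`ContDiffOn ℝ ∞` on `{θ | ζe^{iθ} regular} ×ˢ univ` (the previous theorem at each point, times the polynomial ★ `contDiff_rootProduct`).
[cite: HormanderALPDO1, §1.1 Thm. 1.1.9] [cite: WarnerHASSLG2, Thm. 8.4.3.1] -/
theorem contDiffOn_rootProduct_smul_integral_family_conj_circleDiagonal (hα : ∀ i, α i ≠ 0) (ν : Measure (archLocal L 3 (Matrix.diagonal α) w))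
    [IsFiniteMeasureOnCompacts ν]
    (Θ : P × Matrix (Fin 3) (Fin 3) ℂ → E) (hΘ : ContDiff ℝ ∞ Θ) {C : Set (archLocal L 3 (Matrix.diagonal α) w)} (hC : IsCompact C)
    (hΘC : ∀ (q : P) (k : archLocal L 3 (Matrix.diagonal α) w), k ∉ C → Θ (q, ((k : GL (Fin 3) ℂ) : Matrix (Fin 3) (Fin 3) ℂ)) = 0)
    (ζ : Circle) :
    ContDiffOn ℝ ∞ (fun z : (Fin 3 → ℝ) × P => (rootProduct z.1 : ℝ) • ∫ g : archLocal L 3 (Matrix.diagonal α) w,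
      Θ (z.2, (((g * ⟨circleDiagonal 3 (fun k => ζ * Circle.exp (z.1 k)), circleDiagonal_mem_archLocal_diagonal L 3 α w _⟩ * g⁻¹ :
        archLocal L 3 (Matrix.diagonal α) w) : GL (Fin 3) ℂ) : Matrix (Fin 3) (Fin 3) ℂ)) ∂ν)
      ({θ : Fin 3 → ℝ | Injective fun k => ζ * Circle.exp (θ k)} ×ˢ (univ : Set P)) := by
  intro z hz
  refine ContDiffAt.contDiffWithinAt ?_
  have h := contDiffAt_integral_family_conj_circleDiagonal L α w hα ν Θ hΘ hC hΘC ζ (θ₀ := z.1) hz.1 z.2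
  exact ((contDiff_rootProduct.comp contDiff_fst).contDiffAt).smul h

end Par

/-! ## §2 (J1-loc) All joint jets of the central model are bounded on a chamber piece times a compact parameter set -/

section Loc

variable (L : Type) [Field L] (α : Fin 3 → L) (w : {w : InfinitePlace L // IsComplex w})
  [MeasurableSpace (archLocal L 3 (Matrix.diagonal α) w)] [BorelSpace (archLocal L 3 (Matrix.diagonal α) w)]
  {P : Type*} [NormedAddCommGroup P] [NormedSpace ℝ P] [FiniteDimensional ℝ P]

/-- **(J1-loc) JOINT JET BOUNDS OF THE CENTRAL MODEL ON ONE CHAMBER PIECE.**  `ν` a Haar measure on `G_w` (any of the 8 sign patterns, real weights), `Θ : P × M₃(ℂ) → ℂ`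
jointly `C^∞` vanishing off a compact `C ⊆ G_w` for every `q`, `K ⊆ P` compact, `ζ` a centre, `σ` a chamber, `n` an order: ONE bound for `‖Dⁿ Ψ‖` on
`(C_σ ∩ B(0,¼)) ×ˢ K`, `Ψ(θ, q) = rootProduct θ • ∫ Θ(q, ↑↑(g·diag(ζe^{iθ})·g⁻¹)) dν` — ★ J1-CORE `exists_forall_norm_iteratedFDeriv_le_of_smul_integral_family` at `V₁ := Fin 3 → ℝ`,
`κ_g θ := ↑↑(g·diag(ζe^{iθ})·g⁻¹)`, `C_X := coe '' C ∪ (range coe)ᶜ`, on `Sθ := C_σ ∩ B(0,½)` (regular: ★ `angleChart_ne_of_mem_chamber_ball`; properness ★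
`isCompact_setOf_exists_conj_circleDiagonal_mem`; smoothness §1), with the ENGINE ★ (B3-ENGINE) §6 `exists_forall_norm_iteratedFDeriv_rootProduct_smul_orbital_comp_clm_le`
(Harish-Chandra ∕ Warner II Thm. 8.4.3.1 at every frame) at `E′ := ↥K →ᵇ ℂ`. [cite: WarnerHASSLG2, Thm. 8.4.3.1] [cite: HormanderALPDO1, §1.1 Thms. 1.1.8, 1.1.9]
[cite: Bouaziz1994IntegralesOrbitales, §3.1 (I₁) p. 579] -/
theorem exists_forall_norm_iteratedFDeriv_rootProduct_smul_integral_family_le (hα : ∀ i, α i ≠ 0) (hreal : ∀ i, (w.1.embedding (α i)).im = 0)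
    (ν : Measure (archLocal L 3 (Matrix.diagonal α) w)) [ν.IsHaarMeasure] [ν.IsMulRightInvariant]
    (Θ : P × Matrix (Fin 3) (Fin 3) ℂ → ℂ) (hΘ : ContDiff ℝ ∞ Θ) {C : Set (archLocal L 3 (Matrix.diagonal α) w)} (hC : IsCompact C)
    (hΘC : ∀ (q : P) (k : archLocal L 3 (Matrix.diagonal α) w), k ∉ C → Θ (q, ((k : GL (Fin 3) ℂ) : Matrix (Fin 3) (Fin 3) ℂ)) = 0)
    {K : Set P} (hK : IsCompact K) (ζ : Circle) (σ : Equiv.Perm (Fin 3)) (n : ℕ) :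
    ∃ B : ℝ, ∀ z ∈ ({θ : Fin 3 → ℝ | θ (σ 0) < θ (σ 1) ∧ θ (σ 1) < θ (σ 2)} ∩ ball (0 : Fin 3 → ℝ) (1 / 4)) ×ˢ K,
      ‖iteratedFDeriv ℝ n (fun z : (Fin 3 → ℝ) × P => (rootProduct z.1 : ℝ) • ∫ g : archLocal L 3 (Matrix.diagonal α) w,
        Θ (z.2, (((g * ⟨circleDiagonal 3 (fun k => ζ * Circle.exp (z.1 k)), circleDiagonal_mem_archLocal_diagonal L 3 α w _⟩ * g⁻¹ :
          archLocal L 3 (Matrix.diagonal α) w) : GL (Fin 3) ℂ) : Matrix (Fin 3) (Fin 3) ℂ)) ∂ν) z‖ ≤ B := by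
  -- the datum `κ`, the support set `C_X`, the two angle regions
  set κ : archLocal L 3 (Matrix.diagonal α) w → (Fin 3 → ℝ) → Matrix (Fin 3) (Fin 3) ℂ := fun g θ =>
    (((g * ⟨circleDiagonal 3 (fun k => ζ * Circle.exp (θ k)), circleDiagonal_mem_archLocal_diagonal L 3 α w _⟩ * g⁻¹ :
      archLocal L 3 (Matrix.diagonal α) w) : GL (Fin 3) ℂ) : Matrix (Fin 3) (Fin 3) ℂ) with hκ
  set coeM : archLocal L 3 (Matrix.diagonal α) w → Matrix (Fin 3) (Fin 3) ℂ := fun k => ((k : GL (Fin 3) ℂ) : Matrix (Fin 3) (Fin 3) ℂ) with hcoeM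
  have hinj : Injective coeM := fun k k' h => Subtype.ext (Units.ext h)
  set C_X : Set (Matrix (Fin 3) (Fin 3) ℂ) := coeM '' C ∪ (range coeM)ᶜ with hC_X
  have hCX : ∀ k : archLocal L 3 (Matrix.diagonal α) w, coeM k ∈ C_X ↔ k ∈ C := by
    intro k
    refine ⟨fun h => ?_, fun h => Or.inl ⟨k, h, rfl⟩⟩
    rcases h with ⟨k', hk', hkk'⟩ | h
    · rwa [← hinj hkk']
    · exact absurd (mem_range_self k) h
  set Sθ : Set (Fin 3 → ℝ) := {θ : Fin 3 → ℝ | θ (σ 0) < θ (σ 1) ∧ θ (σ 1) < θ (σ 2)} ∩ ball (0 : Fin 3 → ℝ) (1 / 2) with hSθ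
  set Sθ' : Set (Fin 3 → ℝ) := {θ : Fin 3 → ℝ | θ (σ 0) < θ (σ 1) ∧ θ (σ 1) < θ (σ 2)} ∩ ball (0 : Fin 3 → ℝ) (1 / 4) with hSθ'
  have hSθo : IsOpen Sθ := (isOpen_chamber σ).inter isOpen_ball
  have hS' : Sθ' ⊆ Sθ := fun θ hθ => ⟨hθ.1, ball_subset_ball (by norm_num) hθ.2⟩
  have hreg : ∀ θ ∈ Sθ, Injective fun k => ζ * Circle.exp (θ k) := fun θ hθ i j hij => by
    by_contra hne; exact angleChart_ne_of_mem_chamber_ball ζ σ hθ i j hne hij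
  -- J1-CORE's hypotheses
  have h0 : ∀ (q : P) (X : Matrix (Fin 3) (Fin 3) ℂ), X ∉ C_X → Θ (q, X) = 0 := by
    intro q X hX
    by_cases hXr : X ∈ range coeM
    · obtain ⟨k, rfl⟩ := hXr
      exact hΘC q k fun hk => hX ((hCX k).2 hk)
    · exact absurd (Or.inr hXr) hX
  have hκc : ∀ θ ∈ Sθ, Continuous fun g => κ g θ := fun θ _ =>
    (Units.continuous_val.comp continuous_subtype_val).comp ((continuous_id.mul continuous_const).mul continuous_inv)
  have hprop : ∀ θ ∈ Sθ, ∃ C' : Set (archLocal L 3 (Matrix.diagonal α) w), IsCompact C' ∧ ∀ g, κ g θ ∈ C_X → g ∈ C' := by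
    intro θ hθ
    have hK1 : IsCompact ({fun k => ζ * Circle.exp (θ k)} : Set (Fin 3 → Circle)) := isCompact_singleton
    have hK1r : ({fun k => ζ * Circle.exp (θ k)} : Set (Fin 3 → Circle)) ⊆ {z | Injective z} := by
      rintro _ rfl; exact hreg θ hθ
    refine ⟨_, isCompact_setOf_exists_conj_circleDiagonal_mem L 3 α w hα hK1 hK1r hC, fun g hg => ?_⟩
    exact ⟨_, rfl, (hCX _).1 hg⟩
  have hΨ := (contDiffOn_rootProduct_smul_integral_family_conj_circleDiagonal L α w hα ν Θ hΘ hC hΘC ζ).mono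
    (show Sθ ×ˢ (univ : Set P) ⊆ {θ : Fin 3 → ℝ | Injective fun k => ζ * Circle.exp (θ k)} ×ˢ (univ : Set P) from prod_mono hreg le_rfl)
  -- the ENGINE at `E′ := ↥K →ᵇ ℂ`
  have hEng : ∀ G : Matrix (Fin 3) (Fin 3) ℂ → (↥K →ᵇ ℂ), ContDiff ℝ ∞ G → (∀ X, X ∉ C_X → G X = 0) → ∀ a : ℕ, ∃ Mb : ℝ, ∀ θ ∈ Sθ', ∀ ℓ : (↥K →ᵇ ℂ) →L[ℝ] ℂ,
      ‖iteratedFDeriv ℝ a (fun θ : Fin 3 → ℝ => (rootProduct θ : ℝ) • ∫ g, ℓ (G (κ g θ)) ∂ν) θ‖ ≤ ‖ℓ‖ * Mb := by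
    intro G hG hG0 a
    have hGc : HasCompactSupport fun k : archLocal L 3 (Matrix.diagonal α) w => G ((k : GL (Fin 3) ℂ) : Matrix (Fin 3) (Fin 3) ℂ) :=
      HasCompactSupport.intro hC fun k hk => hG0 _ fun h => hk ((hCX k).1 h)
    obtain ⟨Mb, hMb⟩ := exists_forall_norm_iteratedFDeriv_rootProduct_smul_orbital_comp_clm_le (E := ℂ) L α w hα hreal ν G hG hGc ζ σ a
    exact ⟨Mb, fun θ hθ ℓ => hMb θ hθ ℓ⟩
  obtain ⟨B, hB⟩ := exists_forall_norm_iteratedFDeriv_le_of_smul_integral_family ν (fun θ : Fin 3 → ℝ => rootProduct θ) κ hSθo hS' isOpen_univ hK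
    (subset_univ K) hΘ h0 hκc hprop hΨ (fun z _ => rfl) hEng n
  exact ⟨B, fun z hz => hB z ⟨hz.1, hz.2⟩⟩

/-- **(J1-loc) ON ALL SIX CHAMBERS AT ONCE**: one bound for `‖Dⁿ Ψ‖` on `{θ pairwise distinct, |θ| < ¼} ×ˢ K` (§0 `exists_perm_mem_chamber` + the previous theorem on each
chamber). [cite: WarnerHASSLG2, Thm. 8.4.3.1] [cite: Bouaziz1994IntegralesOrbitales, §3.1 (I₁) p. 579] -/
theorem exists_forall_norm_iteratedFDeriv_rootProduct_smul_integral_family_le_of_injective (hα : ∀ i, α i ≠ 0) (hreal : ∀ i, (w.1.embedding (α i)).im = 0)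
    (ν : Measure (archLocal L 3 (Matrix.diagonal α) w)) [ν.IsHaarMeasure] [ν.IsMulRightInvariant]
    (Θ : P × Matrix (Fin 3) (Fin 3) ℂ → ℂ) (hΘ : ContDiff ℝ ∞ Θ) {C : Set (archLocal L 3 (Matrix.diagonal α) w)} (hC : IsCompact C)
    (hΘC : ∀ (q : P) (k : archLocal L 3 (Matrix.diagonal α) w), k ∉ C → Θ (q, ((k : GL (Fin 3) ℂ) : Matrix (Fin 3) (Fin 3) ℂ)) = 0)
    {K : Set P} (hK : IsCompact K) (ζ : Circle) (n : ℕ) :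
    ∃ B : ℝ, ∀ z ∈ ({θ : Fin 3 → ℝ | Injective θ} ∩ ball (0 : Fin 3 → ℝ) (1 / 4)) ×ˢ K,
      ‖iteratedFDeriv ℝ n (fun z : (Fin 3 → ℝ) × P => (rootProduct z.1 : ℝ) • ∫ g : archLocal L 3 (Matrix.diagonal α) w,
        Θ (z.2, (((g * ⟨circleDiagonal 3 (fun k => ζ * Circle.exp (z.1 k)), circleDiagonal_mem_archLocal_diagonal L 3 α w _⟩ * g⁻¹ :
          archLocal L 3 (Matrix.diagonal α) w) : GL (Fin 3) ℂ) : Matrix (Fin 3) (Fin 3) ℂ)) ∂ν) z‖ ≤ B := by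
  choose B hB using fun σ : Equiv.Perm (Fin 3) =>
    exists_forall_norm_iteratedFDeriv_rootProduct_smul_integral_family_le L α w hα hreal ν Θ hΘ hC hΘC hK ζ σ n
  refine ⟨∑ σ, max (B σ) 0, fun z hz => ?_⟩
  obtain ⟨σ, hσ⟩ := exists_perm_mem_chamber hz.1.1
  exact ((hB σ z ⟨⟨hσ, hz.1.2⟩, hz.2⟩).trans (le_max_left _ _)).trans
    (Finset.single_le_sum (f := fun σ => max (B σ) 0) (fun σ _ => le_max_right _ _) (Finset.mem_univ σ))

end Loc

/-! ## §3 HEAD (J1): local jet bounds of `orbFamGExt` at a scalar corner from a CENTRAL MODEL on the `G`-regular set -/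

section Head

variable (L : Type) [Field L] [NumberField L] [IsCMField L] (α : Fin 3 → L)
  [MeasurableSpace ↥(arch (↥(maximalRealSubfield L)) L (IsCMField.complexConj L) 3 (Matrix.diagonal α))]
  [BorelSpace ↥(arch (↥(maximalRealSubfield L)) L (IsCMField.complexConj L) 3 (Matrix.diagonal α))]
  (ν' : Measure ↥(arch (↥(maximalRealSubfield L)) L (IsCMField.complexConj L) 3 (Matrix.diagonal α))) [ν'.IsHaarMeasure] [ν'.IsMulRightInvariant]
  (a' : ↥(arch (↥(maximalRealSubfield L)) L (IsCMField.complexConj L) 3 (Matrix.diagonal α)) → ℂ)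
  (S' : Finset {w : InfinitePlace L // IsComplex w})

/-- **(B3-JUNCTION) J1 HEAD — LOCAL JET BOUNDS OF `orbFamGExt` AT A SCALAR CORNER FROM A CENTRAL MODEL.**  Data: the place `w ∉ S′` (real weights `hreal`), a base point `x`
LITERALLY scalar at `w` (`hxw : x w l = x w l′` — the cube + `cexp`-coincidence form of the socket gives this, ★ `eq_of_circleExp_eq_of_mem_Ico`), a centre `ζ` and a relabelling
`τ` of the three angles (J2: `ζ = e^{i x_{w 0}}`, `τ = lineOf (formSign α w)`), a finite-dimensional parameter space `P` with a continuous linear chart `A`, a neighbourhood `U` of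
`x` mapped by `A` into the open `O ⊆ P`, a Haar measure `ν_w` on `G_w`, the PARTIAL MODEL `Θ : P × M₃(ℂ) → ℂ` — `C^∞` on `O ×ˢ univ` with ONE compact `C ⊆ G_w` off which `Θ(q, ↑↑k) = 0`
for all `q ∈ O` ((J-par): ★ (A4′)) —, a unit `u` (`C^∞` on `U`), the CENTRAL MODEL IDENTITY `hfac` on `U ∩ RegG S′`:
`orbFamGExt S′ c = u c · π(θ(c)) · ∫_{G_w} Θ(A c, ↑↑(g · diag(ζ e^{iθ(c)}) · g⁻¹)) dν_w`, `θ(c)_k = c_{w, τ⁻¹ k} − x_{w, τ⁻¹ k}` ((J-iso) + ★ (A5a): file J2), and clause (I₂) `h1`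
(★ (A5) `contDiffOn_orbFamGExt_inRegG`).  CONCLUSION: `∃ U′ ∈ 𝓝 x, BddAbove (‖Dⁿ(orbFamGExt ν′ a′ S′)‖ '' (U′ ∩ InRegG (slotSign α) S′))` — the O-L1d₀ socket `hC₀` of
★ `smoothBounded_orbFamGExt_of_strata₄` at `x`, once J2 supplies the model.  Proof: `q`-cutoff (★ `exists_contDiff_tsupport_subset_eventually_eq_one`) ⇒ §2 on
`{θ regular, |θ| < ¼} ×ˢ A(B̄(x,1))`; pull-back along `c ↦ (θ(c), A c)` (★ `bddAbove_norm_iteratedFDeriv_comp_clm_image` after ★ `iteratedFDeriv_comp_add_right`); Leibniz with `u`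
(★ `exists_nhds_bddAbove_norm_iteratedFDeriv_mul_of_contDiffOn`); on the open `U₀ ∩ RegG S′` the family IS the model, so its jets are bounded there; §0 with ★ `dense_regG` and the
continuity of `Dⁿ orbFamGExt` on the open `InRegG` (`h1`) carries the bound to `U′ ∩ InRegG` — across the compact wall at `w` and the compact∕real walls at the other places.
[cite: WarnerHASSLG2, Thm. 8.4.3.1] [cite: Varadarajan1977, Part I §1.12] [cite: Bouaziz1994IntegralesOrbitales, §3.1 (I₁)–(I₂) p. 579] [cite: HormanderALPDO1, §1.1 Thms. 1.1.8, 1.1.9] -/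
theorem exists_nhds_bddAbove_norm_iteratedFDeriv_orbFamGExt_of_centralModel (hα : ∀ i, α i ≠ 0)
    {w : {w : InfinitePlace L // IsComplex w}} (hw : w ∉ S') (hreal : ∀ i, (w.1.embedding (α i)).im = 0)
    {x : {w : InfinitePlace L // IsComplex w} → Fin 3 → ℝ} (hxw : ∀ l l' : Fin 3, x w l = x w l') (ζ : Circle) (τ : Equiv.Perm (Fin 3))
    {P : Type*} [NormedAddCommGroup P] [NormedSpace ℝ P] [FiniteDimensional ℝ P] (A : ({w : InfinitePlace L // IsComplex w} → Fin 3 → ℝ) →L[ℝ] P)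
    {U : Set ({w : InfinitePlace L // IsComplex w} → Fin 3 → ℝ)} (hU : U ∈ 𝓝 x) {O : Set P} (hO : IsOpen O) (hAO : MapsTo A U O)
    [MeasurableSpace (archLocal L 3 (Matrix.diagonal α) w)] [BorelSpace (archLocal L 3 (Matrix.diagonal α) w)]
    (νw : Measure (archLocal L 3 (Matrix.diagonal α) w)) [νw.IsHaarMeasure] [νw.IsMulRightInvariant]
    (Θ : P × Matrix (Fin 3) (Fin 3) ℂ → ℂ) (hΘ : ContDiffOn ℝ ∞ Θ (O ×ˢ (univ : Set (Matrix (Fin 3) (Fin 3) ℂ))))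
    (hΘc : ∃ C : Set (archLocal L 3 (Matrix.diagonal α) w), IsCompact C ∧
      ∀ q ∈ O, ∀ k : archLocal L 3 (Matrix.diagonal α) w, k ∉ C → Θ (q, ((k : GL (Fin 3) ℂ) : Matrix (Fin 3) (Fin 3) ℂ)) = 0)
    (u : ({w : InfinitePlace L // IsComplex w} → Fin 3 → ℝ) → ℂ) (hu : ContDiffOn ℝ ∞ u U)
    (hfac : ∀ c ∈ U ∩ RegG S', orbFamGExt L α ν' a' S' c =
      u c * (((rootProduct fun k => c w (τ.symm k) - x w (τ.symm k) : ℝ) : ℂ) * ∫ g : archLocal L 3 (Matrix.diagonal α) w,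
        Θ (A c, (((g * ⟨circleDiagonal 3 (fun k => ζ * Circle.exp (c w (τ.symm k) - x w (τ.symm k))), circleDiagonal_mem_archLocal_diagonal L 3 α w _⟩ * g⁻¹ :
          archLocal L 3 (Matrix.diagonal α) w) : GL (Fin 3) ℂ) : Matrix (Fin 3) (Fin 3) ℂ)) ∂νw))
    (h1 : ContDiffOn ℝ ∞ (orbFamGExt L α ν' a' S') (InRegG (slotSign L α) S')) (n : ℕ) :
    ∃ U' ∈ 𝓝 x, BddAbove ((fun c => ‖iteratedFDeriv ℝ n (orbFamGExt L α ν' a' S') c‖) '' (U' ∩ InRegG (slotSign L α) S')) := by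
  classical
  obtain ⟨Cg, hCg, hΘCg⟩ := hΘc
  have hxU : x ∈ U := mem_of_mem_nhds hU
  -- STEP 1: the `q`-cutoff making the partial model global
  obtain ⟨χ, hχd, -, hχO, hχ1⟩ := exists_contDiff_tsupport_subset_eventually_eq_one (hO.mem_nhds (hAO hxU))
  obtain ⟨O₁, hO₁1, hO₁o, hAxO₁⟩ := _root_.mem_nhds_iff.1 hχ1
  obtain ⟨Θχ, hΘχdef⟩ : ∃ Θχ : P × Matrix (Fin 3) (Fin 3) ℂ → ℂ, Θχ = fun p => (χ p.1 : ℝ) • Θ p := ⟨_, rfl⟩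
  have hΘχd : ContDiff ℝ ∞ Θχ := by
    rw [hΘχdef, contDiff_iff_contDiffAt]
    intro p
    by_cases hq : p.1 ∈ O
    · have hnhds : O ×ˢ (univ : Set (Matrix (Fin 3) (Fin 3) ℂ)) ∈ 𝓝 p := by
        rw [← Prod.mk.eta (p := p)]; exact prod_mem_nhds (hO.mem_nhds hq) univ_mem
      exact ((hχd.comp contDiff_fst).contDiffAt).smul (hΘ.contDiffAt hnhds)
    · have hq' : p.1 ∉ tsupport χ := fun h => hq (hχO h)
      have hev : χ =ᶠ[𝓝 p.1] 0 := notMem_tsupport_iff_eventuallyEq.1 hq'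
      have hev2 : (fun p : P × Matrix (Fin 3) (Fin 3) ℂ => (χ p.1 : ℝ) • Θ p) =ᶠ[𝓝 p] fun _ => 0 :=
        (continuous_fst.continuousAt.eventually hev).mono fun p' hp' => by
          show (χ p'.1 : ℝ) • Θ p' = 0
          rw [show χ p'.1 = 0 from hp', zero_smul]
      exact contDiffAt_const.congr_of_eventuallyEq hev2
  have hΘχC : ∀ (q : P) (k : archLocal L 3 (Matrix.diagonal α) w), k ∉ Cg → Θχ (q, ((k : GL (Fin 3) ℂ) : Matrix (Fin 3) (Fin 3) ℂ)) = 0 := by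
    intro q k hk
    rw [hΘχdef]
    by_cases hq : χ q = 0
    · show (χ q : ℝ) • _ = 0
      rw [hq, zero_smul]
    · show (χ q : ℝ) • _ = 0
      rw [hΘCg q (hχO (subset_tsupport _ (Function.mem_support.2 hq))) k hk, smul_zero]
  have hΘχ1 : ∀ q ∈ O₁, ∀ X, Θχ (q, X) = Θ (q, X) := fun q hq X => by
    rw [hΘχdef]; show (χ q : ℝ) • Θ (q, X) = Θ (q, X); rw [show χ q = 1 from hO₁1 hq, one_smul]
  -- STEP 2: the charts `Tθ c = (c_{w,τ⁻¹k})_k`, `Ach c = (Tθ c, A c)`, the translation `p₀ = (−Tθ x, 0)`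
  obtain ⟨Tθ, hTθ⟩ : ∃ Tθ : ({w : InfinitePlace L // IsComplex w} → Fin 3 → ℝ) →L[ℝ] (Fin 3 → ℝ), ∀ c k, Tθ c k = c w (τ.symm k) :=
    ⟨ContinuousLinearMap.pi fun k : Fin 3 =>
      (ContinuousLinearMap.proj (R := ℝ) (φ := fun _ : Fin 3 => ℝ) (τ.symm k)).comp
        (ContinuousLinearMap.proj (R := ℝ) (φ := fun _ : {w : InfinitePlace L // IsComplex w} => Fin 3 → ℝ) w),
      fun c k => rfl⟩
  have hθc : ∀ c : {w : InfinitePlace L // IsComplex w} → Fin 3 → ℝ, (fun k => c w (τ.symm k) - x w (τ.symm k)) = Tθ c - Tθ x := fun c => by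
    funext k; rw [Pi.sub_apply, hTθ, hTθ]
  set Ach : ({w : InfinitePlace L // IsComplex w} → Fin 3 → ℝ) →L[ℝ] (Fin 3 → ℝ) × P := Tθ.prod A with hAch
  set p₀ : (Fin 3 → ℝ) × P := (-(Tθ x), 0) with hp₀
  have hAchp : ∀ c, Ach c + p₀ = (Tθ c - Tθ x, A c) := fun c => by
    rw [hAch, hp₀, ContinuousLinearMap.prod_apply, Prod.mk_add_mk, add_zero, sub_eq_add_neg]
  -- STEP 3: the central model `Ψ` of the global family, its smoothness and its jets
  obtain ⟨Ψ, hΨdef⟩ : ∃ Ψ : (Fin 3 → ℝ) × P → ℂ, Ψ = fun z => (rootProduct z.1 : ℝ) • ∫ g : archLocal L 3 (Matrix.diagonal α) w,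
      Θχ (z.2, (((g * ⟨circleDiagonal 3 (fun k => ζ * Circle.exp (z.1 k)), circleDiagonal_mem_archLocal_diagonal L 3 α w _⟩ * g⁻¹ :
        archLocal L 3 (Matrix.diagonal α) w) : GL (Fin 3) ℂ) : Matrix (Fin 3) (Fin 3) ℂ)) ∂νw := ⟨_, rfl⟩
  have hRo : IsOpen {θ : Fin 3 → ℝ | Injective θ} := by
    have h : {θ : Fin 3 → ℝ | Injective θ} = ⋂ p ∈ {p : Fin 3 × Fin 3 | p.1 ≠ p.2}, {θ | θ p.1 ≠ θ p.2} := by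
      ext θ
      simp only [mem_setOf_eq, mem_iInter, Prod.forall]
      exact ⟨fun hθ i j hij h => hij (hθ h), fun h i j hij => by_contra fun hne => h i j hne hij⟩
    rw [h]
    exact (Set.toFinite _).isOpen_biInter fun p _ => isOpen_ne_fun (continuous_apply p.1) (continuous_apply p.2)
  have hreg2 : {θ : Fin 3 → ℝ | Injective θ} ∩ ball (0 : Fin 3 → ℝ) (1 / 2) ⊆ {θ : Fin 3 → ℝ | Injective fun k => ζ * Circle.exp (θ k)} := by
    intro θ hθ
    obtain ⟨σ, hσ⟩ := exists_perm_mem_chamber hθ.1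
    intro i j hij
    by_contra hne
    exact angleChart_ne_of_mem_chamber_ball ζ σ ⟨hσ, hθ.2⟩ i j hne hij
  set O' : Set ((Fin 3 → ℝ) × P) := ({θ : Fin 3 → ℝ | Injective θ} ∩ ball (0 : Fin 3 → ℝ) (1 / 4)) ×ˢ (univ : Set P) with hO'
  have hO'o : IsOpen O' := (hRo.inter isOpen_ball).prod isOpen_univ
  have hΨs : ContDiffOn ℝ ∞ Ψ O' := by
    rw [hΨdef]
    refine (contDiffOn_rootProduct_smul_integral_family_conj_circleDiagonal L α w hα νw Θχ hΘχd hCg hΘχC ζ).mono ?_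
    exact prod_mono (fun θ hθ => hreg2 ⟨hθ.1, ball_subset_ball (by norm_num) hθ.2⟩) le_rfl
  have hK : IsCompact (A '' closedBall x 1) := (isCompact_closedBall x 1).image A.continuous
  have hΨb : ∀ k : ℕ, ∃ B : ℝ, ∀ z ∈ ({θ : Fin 3 → ℝ | Injective θ} ∩ ball (0 : Fin 3 → ℝ) (1 / 4)) ×ˢ (A '' closedBall x 1), ‖iteratedFDeriv ℝ k Ψ z‖ ≤ B := by
    intro k
    rw [hΨdef]
    exact exists_forall_norm_iteratedFDeriv_rootProduct_smul_integral_family_le_of_injective L α w hα hreal νw Θχ hΘχd hCg hΘχC hK ζ k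
  -- the translated model `H₂ y = Ψ (y + p₀)` on the open `O₂ = (· + p₀) ⁻¹' O'`
  obtain ⟨H₂, hH₂def⟩ : ∃ H₂ : (Fin 3 → ℝ) × P → ℂ, H₂ = fun y => Ψ (y + p₀) := ⟨_, rfl⟩
  set O₂ : Set ((Fin 3 → ℝ) × P) := (fun y => y + p₀) ⁻¹' O' with hO₂
  have hO₂o : IsOpen O₂ := hO'o.preimage (continuous_id.add continuous_const)
  have hH₂s : ContDiffOn ℝ ∞ H₂ O₂ := by
    rw [hH₂def]; exact hΨs.comp (contDiffOn_id.add contDiffOn_const) fun y hy => hy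
  have hH₂j : ∀ (k : ℕ) (y : (Fin 3 → ℝ) × P), iteratedFDeriv ℝ k H₂ y = iteratedFDeriv ℝ k Ψ (y + p₀) := fun k y => by
    rw [hH₂def, iteratedFDeriv_comp_add_right]
  -- STEP 4: the regular neighbourhood `U₀` of `x` and the off-wall set `Oc = U₀ ∩ RegG S′`
  have hcont : ContinuousAt (fun c : {w : InfinitePlace L // IsComplex w} → Fin 3 → ℝ => Tθ c - Tθ x) x :=
    (Tθ.continuous.sub continuous_const).continuousAt
  have hpre : (fun c : {w : InfinitePlace L // IsComplex w} → Fin 3 → ℝ => Tθ c - Tθ x) ⁻¹' ball (0 : Fin 3 → ℝ) (1 / 4) ∈ 𝓝 x :=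
    hcont.preimage_mem_nhds (isOpen_ball.mem_nhds (by simp))
  set U₀ : Set ({w : InfinitePlace L // IsComplex w} → Fin 3 → ℝ) :=
    interior U ∩ A ⁻¹' O₁ ∩ interior ((fun c => Tθ c - Tθ x) ⁻¹' ball (0 : Fin 3 → ℝ) (1 / 4)) ∩ ball x 1 with hU₀
  have hU₀o : IsOpen U₀ := ((isOpen_interior.inter (hO₁o.preimage A.continuous)).inter isOpen_interior).inter isOpen_ball
  have hxU₀ : x ∈ U₀ := ⟨⟨⟨mem_interior_iff_mem_nhds.2 hU, hAxO₁⟩, mem_interior_iff_mem_nhds.2 hpre⟩, mem_ball_self zero_lt_one⟩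
  set Oc : Set ({w : InfinitePlace L // IsComplex w} → Fin 3 → ℝ) := U₀ ∩ RegG S' with hOc
  have hOco : IsOpen Oc := hU₀o.inter (isOpen_regG S')
  -- on `Oc` the angles are pairwise distinct and small, the parameter lies in `A '' closedBall x 1`
  have hθreg : ∀ c ∈ Oc, Injective (Tθ c - Tθ x) ∧ Tθ c - Tθ x ∈ ball (0 : Fin 3 → ℝ) (1 / 4) := by
    intro c hc
    have h4 : c ∈ (fun c => Tθ c - Tθ x) ⁻¹' ball (0 : Fin 3 → ℝ) (1 / 4) := interior_subset hc.1.1.2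
    refine ⟨fun k k' hkk' => ?_, h4⟩
    have hinj : Injective fun i : Fin 3 => Circle.exp (c w i) := hc.2.1 w hw
    have h' : c w (τ.symm k) = c w (τ.symm k') := by
      have := hkk'
      rw [Pi.sub_apply, Pi.sub_apply, hTθ, hTθ, hTθ, hTθ, hxw (τ.symm k) (τ.symm k')] at this
      linarith
    exact τ.symm.injective (hinj (by simp only [h']))
  have hmaps : MapsTo Ach Oc O₂ := by
    intro c hc
    show Ach c + p₀ ∈ O'
    rw [hAchp c]
    exact ⟨hθreg c hc, mem_univ _⟩
  have hAK : ∀ c ∈ Oc, A c ∈ A '' closedBall x 1 := fun c hc => ⟨c, ball_subset_closedBall hc.1.2, rfl⟩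
  -- STEP 5: jets of the pulled-back model `H₂ ∘ Ach` on `Oc`, Leibniz with `u`
  have hHb : ∀ k ≤ n, ∃ U'' ∈ 𝓝 x, BddAbove ((fun c => ‖iteratedFDeriv ℝ k (H₂ ∘ Ach) c‖) '' (U'' ∩ Oc)) := by
    intro k _
    obtain ⟨B, hB⟩ := hΨb k
    refine ⟨univ, univ_mem, ?_⟩
    rw [univ_inter]
    refine bddAbove_norm_iteratedFDeriv_comp_clm_image Ach hO₂o (hH₂s.of_le (mod_cast le_top)) hmaps ⟨B, ?_⟩
    rintro _ ⟨_, ⟨c, hc, rfl⟩, rfl⟩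
    show ‖iteratedFDeriv ℝ k H₂ (Ach c)‖ ≤ B
    rw [hH₂j, hAchp]
    exact hB _ ⟨hθreg c hc, hAK c hc⟩
  have huV : ContDiffOn ℝ ∞ u (interior U) := hu.mono interior_subset
  obtain ⟨U₁, hU₁, hB₁⟩ := exists_nhds_bddAbove_norm_iteratedFDeriv_mul_of_contDiffOn isOpen_interior (mem_interior_iff_mem_nhds.2 hU) huV hOco
    ((hH₂s.comp Ach.contDiff.contDiffOn hmaps).of_le (mod_cast le_top)) hHb
  -- STEP 6: on the open `Oc` the family IS the model
  have hEq : ∀ c ∈ Oc, orbFamGExt L α ν' a' S' c = u c * (H₂ ∘ Ach) c := by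
    intro c hc
    have hpt : ∀ k, c w (τ.symm k) - x w (τ.symm k) = (Tθ c - Tθ x) k := fun k => by rw [Pi.sub_apply, hTθ, hTθ]
    rw [hfac c ⟨interior_subset hc.1.1.1.1, hc.2⟩, comp_apply, hH₂def]
    show _ = u c * Ψ (Ach c + p₀)
    rw [hAchp, hΨdef, hθc c]
    dsimp only
    rw [Complex.real_smul]
    congr 2
    refine integral_congr_ae (Eventually.of_forall fun g => ?_)
    dsimp only
    rw [hΘχ1 (A c) hc.1.1.1.2]
    simp only [hpt]
  have hEqj : ∀ c ∈ Oc, iteratedFDeriv ℝ n (orbFamGExt L α ν' a' S') c = iteratedFDeriv ℝ n (fun c => u c * (H₂ ∘ Ach) c) c := by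
    intro c hc
    have hev : orbFamGExt L α ν' a' S' =ᶠ[𝓝 c] fun c => u c * (H₂ ∘ Ach) c :=
      Filter.eventuallyEq_of_mem (hOco.mem_nhds hc) fun y hy => hEq y hy
    exact (hev.iteratedFDeriv ℝ n).eq_of_nhds
  -- STEP 7: the bound on `U₂ ∩ RegG S′` and its passage to `U₂ ∩ InRegG` (§0, ★ `dense_regG`, `h1`)
  set U₂ : Set ({w : InfinitePlace L // IsComplex w} → Fin 3 → ℝ) := interior U₁ ∩ U₀ with hU₂
  have hU₂o : IsOpen U₂ := isOpen_interior.inter hU₀o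
  have hxU₂ : x ∈ U₂ := ⟨mem_interior_iff_mem_nhds.2 hU₁, hxU₀⟩
  have hcontn : ContinuousOn (fun c => ‖iteratedFDeriv ℝ n (orbFamGExt L α ν' a' S') c‖) (InRegG (slotSign L α) S') := by
    have hV := isOpen_inRegG (slotSign L α) S'
    refine ContinuousOn.norm ?_
    exact (h1.continuousOn_iteratedFDerivWithin (m := n) (mod_cast le_top) hV.uniqueDiffOn).congr
      fun c hc => (iteratedFDerivWithin_of_isOpen n hV hc).symm
  refine ⟨U₂, hU₂o.mem_nhds hxU₂, ?_⟩
  refine bddAbove_image_inter_of_dense hU₂o (isOpen_inRegG (slotSign L α) S') hcontn (dense_regG S') (hB₁.mono ?_)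
  rintro _ ⟨c, ⟨⟨hcU₂, -⟩, hcreg⟩, rfl⟩
  have hcOc : c ∈ Oc := ⟨hcU₂.2, hcreg⟩
  refine ⟨c, ⟨interior_subset hcU₂.1, hcOc⟩, ?_⟩
  show ‖iteratedFDeriv ℝ n (fun y => u y * (H₂ ∘ Ach) y) c‖ = ‖iteratedFDeriv ℝ n (orbFamGExt L α ν' a' S') c‖
  rw [hEqj c hcOc]

end Head

end Literature.NumberTheory.Rogawski1990

end
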